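import Summits.QuantumFields.QCD.Theses.SpectralDefectExtinction
import Literature.MathematicalPhysics.QuantumFieldTheory.QCDPhaseQuenched
import Literature.MathematicalPhysics.QuantumFieldTheory.SpectralDefectDensity
import Literature.Barriers.QuantumFields.WilsonDeterminantMassSplitting

/-!
# Bridge lemma A toward stub `coareaWegner` of line `Sketch` (skeleton "ResolventCell", gen 2) for
crux `SpectralDefectExtinction.WegnerEstimate` (item stmt-QuantumFields-8966):
the Hellmann–Feynman colour-current identity

For the Hermitian Wilson operator `H(U) = Γ₅ D_W(U, m₀, 1)` (`Γ₅ = spinorLift gammaFive`,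
`D_W = wilsonDirac (fundamentalRep (Fin 3))`) and a quark field `ψ`, the quadratic form
`Q(U) = Re ⟨ψ, H(U) ψ⟩` is an AFFINE function of every single link variable `U(e)`, `e = (z, μ)`:

  `⟨ψ, H(U) ψ⟩ = Σ_p (m₀ + 4) ε_p |ψ_p|² − Re Φ(U)`,
  `Φ(U) = Σ_{e = (x, μ)} Σ_{a b α β} conj ψ(x,a,α) · ε_α (1 − γ_μ)_{αβ} · U(e)_{ab} · ψ(x + μ̂, b, β)`

(`ε = (1, 1, −1, −1)` the diagonal of `γ₅` in the chiral basis; `coareaWegner_quadForm_eq`,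
`coareaWegner_fwdSum_eq_edgeSum`): the backward hops of `D_W` contribute the complex conjugate of the
forward hops (γ₅-hermiticity entrywise, `gammaFiveSign_mul_add_euclideanGamma_mul_gammaFiveSign` and
`ρ(g⁻¹)_{ab} = conj ρ(g)_{ba}` of the tree).  Consequently (`coareaWegner_hellmannFeynman`), along any
one-parameter variation `t ↦ U(e) · g(t)` of ONE link with matrix velocity `X` at `t = 0`,

  `d/dt|₀ Re ⟨ψ, H(U_t) ψ⟩ = J_{e,X}(ψ)
    := 2 Re Σ_{a b α β} conj ψ(z,a,α) (γ₅ · (−½)(1 − γ_μ))_{αβ} (U(e) X)_{ab} ψ(z + μ̂, b, β)`,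

which is EXACTLY the colour-current expression appearing in the registered signatures of
`stub_currentRigidity` / `stub_coareaWegner`.  For a normalised eigenvector `ψ` of an analytic
eigenvalue branch `λ(t)` of `H(U_t)` this is the Hellmann–Feynman formula `λ'(0) = J_{e,X}(ψ)`
(Kato, Perturbation Theory for Linear Operators, II.§6; Erdős–Hasler, AHP 13 (2012) §3: currents as
level velocities).  Valid on every torus `L ≥ 1` (for `L ≤ 2` forward and backward hops may land on
the same pair of sites; the entrywise argument is insensitive to this) and with no hypothesis
`g 0 = 1`.
-/

noncomputable section

namespace Summit.QuantumFields.QCD.Cruxes.WegnerEstimate.ResolventCell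

open MeasureTheory
open scoped Matrix BigOperators
open Literature.MathematicalPhysics.QuantumLattice Literature.MathematicalPhysics.QuantumFieldTheory
  Literature.Probability.LatticeModels
open Matrix
open scoped ComplexOrder

section General

variable {L N : ℕ} {G : Type*} [Group G] (ρ : G →* Matrix (Fin N) (Fin N) ℂ)

/-- A sum over a triple index with the first component pinned collapses to the double sum over the
other two components. -/
theorem coareaWegner_sum_ite_fst_eq {X A B : Type*} [Fintype X] [Fintype A] [Fintype B]
    [DecidableEq X] (s : X) (h : X × A × B → ℂ) :
    ∑ q : X × A × B, (if q.1 = s then h q else 0) = ∑ a, ∑ b, h (s, a, b) := by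
  rw [Fintype.sum_prod_type, Finset.sum_eq_single s (fun y _ hy => by simp [hy]) (by simp)]
  simp only [if_true, Fintype.sum_prod_type]

/-- The sign vector `ε = (1, 1, -1, -1)` of `γ₅` is real. -/
theorem coareaWegner_star_sign (α : Fin 4) :
    star ((![1, 1, -1, -1] : Fin 4 → ℂ) α) = (![1, 1, -1, -1] : Fin 4 → ℂ) α := by
  fin_cases α <;> simp

/-- Algebraic skeleton of the entrywise decomposition `ε_p D_{pq} = (mass) − ½ Σ_μ (F + F̄)`. -/
theorem coareaWegner_entry_aux {ι : Type*} [Fintype ι] (a M M' c : ℂ) (f g F F' : ι → ℂ)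
    (hM : a * M = M') (hf : ∀ i, a * f i = F i) (hg : ∀ i, a * g i = F' i) :
    a * (M - c * ∑ i, (f i + g i)) = M' - c * ∑ i, (F i + F' i) := by
  rw [← hM, mul_sub, Finset.mul_sum, Finset.mul_sum, Finset.mul_sum]
  congr 1
  refine Finset.sum_congr rfl fun i _ => ?_
  rw [← hf, ← hg]
  ring

/-- **Hop decomposition of the quadratic form of `Γ₅ D_W`.**  For a unitary colour representation
`ρ`, any gauge field `U`, real `m`, `r` and any field `ψ`,
`⟨ψ, Γ₅ D_W ψ⟩ = Σ_p (m + 4r) ε_p |ψ_p|² − Re Φ` with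
`Φ = Σ_p Σ_μ Σ_{b β} conj ψ_p · ε_{α(p)} (r − γ_μ)_{α(p) β} · ρ(U(x(p), μ))_{a(p) b} · ψ(x(p) + μ̂, b, β)`
(the forward hops; the backward hops give `conj Φ` by entrywise γ₅-hermiticity). -/
theorem coareaWegner_quadForm_eq [NeZero L] (hρ : ∀ g, ρ g ∈ Matrix.unitaryGroup (Fin N) ℂ)
    (U : GaugeConfig 4 L G) (m r : ℝ) (ψ : TorusSite 4 L × Fin N × Fin 4 → ℂ) :
    star ψ ⬝ᵥ (spinorLift gammaFive * wilsonDirac ρ U m r).mulVec ψ =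
      (∑ p, ((m + 4 * r : ℝ) : ℂ) * ((![1, 1, -1, -1] : Fin 4 → ℂ) p.2.2 * (star (ψ p) * ψ p))) -
        (((∑ p : TorusSite 4 L × Fin N × Fin 4, ∑ μ : Fin 4, ∑ b : Fin N, ∑ β : Fin 4,
            star (ψ p) * ((![1, 1, -1, -1] : Fin 4 → ℂ) p.2.2 *
              ((r : ℂ) • (1 : Matrix (Fin 4) (Fin 4) ℂ) - euclideanGamma μ) p.2.2 β) *
              ρ (U (p.1, μ)) p.2.1 b *
              ψ (Literature.MathematicalPhysics.QuantumFieldTheory.Site.shift p.1 μ, b, β)).re : ℝ) :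
          ℂ) := by
  -- the forward hop amplitude `F p q μ` (nonzero only if `q` sits at `x(p) + μ̂`)
  set F : (TorusSite 4 L × Fin N × Fin 4) → (TorusSite 4 L × Fin N × Fin 4) → Fin 4 → ℂ :=
    fun p q μ => if q.1 = Literature.MathematicalPhysics.QuantumFieldTheory.Site.shift p.1 μ then
      (![1, 1, -1, -1] : Fin 4 → ℂ) p.2.2 *
        ((r : ℂ) • (1 : Matrix (Fin 4) (Fin 4) ℂ) - euclideanGamma μ) p.2.2 q.2.2 *
        ρ (U (p.1, μ)) p.2.1 q.2.1 else 0 with hF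
  have hH : ∀ p q, (spinorLift gammaFive * wilsonDirac ρ U m r :
      Matrix (TorusSite 4 L × Fin N × Fin 4) (TorusSite 4 L × Fin N × Fin 4) ℂ) p q =
      (![1, 1, -1, -1] : Fin 4 → ℂ) p.2.2 * wilsonDirac ρ U m r p q := fun p q => by
    rw [spinorLift_gammaFive_eq_diagonal, diagonal_mul]
  -- entrywise: `ε_p D_{pq} = mass − ½ Σ_μ (F p q μ + conj (F q p μ))`
  have key : ∀ p q, (![1, 1, -1, -1] : Fin 4 → ℂ) p.2.2 * wilsonDirac ρ U m r p q =
      (if p = q then ((m + 4 * r : ℝ) : ℂ) * (![1, 1, -1, -1] : Fin 4 → ℂ) p.2.2 else 0) -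
        (1 / 2 : ℂ) * ∑ μ, (F p q μ + star (F q p μ)) := by
    intro p q
    simp only [wilsonDirac, of_apply]
    refine coareaWegner_entry_aux _ _ _ _ _ _ _ _ ?_ (fun μ => ?_) (fun μ => ?_)
    · split_ifs <;> ring
    · simp only [hF, mul_ite, mul_zero, mul_assoc]
    · simp only [hF]
      split_ifs with hc
      · rw [star_mul', star_mul', coareaWegner_star_sign, unitaryRep_star_apply ρ hρ,
          ← gammaFiveSign_mul_add_euclideanGamma_mul_gammaFiveSign r μ p.2.2 q.2.2]
        have h1 := gammaFiveSign_mul_self q.2.2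
        have : ∀ a b x y : ℂ, b * b = 1 → a * (x * y) = b * (a * x * b) * y := by
          intro a b x y hb
          linear_combination (-(a * x * y)) * hb
        exact this _ _ _ _ h1
      · rw [mul_zero, star_zero]
  -- pointwise form of the summand of the quadratic form
  have hpt : ∀ p q, star (ψ p) * ((![1, 1, -1, -1] : Fin 4 → ℂ) p.2.2 * wilsonDirac ρ U m r p q) * ψ q =
      (if p = q then ((m + 4 * r : ℝ) : ℂ) * ((![1, 1, -1, -1] : Fin 4 → ℂ) p.2.2 * (star (ψ p) * ψ p))
        else 0) -
        (1 / 2 : ℂ) * (∑ μ, star (ψ p) * F p q μ * ψ q + ∑ μ, star (ψ p) * star (F q p μ) * ψ q) := by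
    intro p q
    rw [key, ← Finset.sum_add_distrib]
    have : ∑ μ, (star (ψ p) * F p q μ * ψ q + star (ψ p) * star (F q p μ) * ψ q) =
        star (ψ p) * (∑ μ, (F p q μ + star (F q p μ))) * ψ q := by
      rw [Finset.mul_sum, Finset.sum_mul]
      exact Finset.sum_congr rfl fun μ _ => by ring
    rw [this]
    split_ifs with h
    · subst h; ring
    · ring
  -- the forward sum, re-indexed
  have hfwd : ∑ p, ∑ q, ∑ μ, star (ψ p) * F p q μ * ψ q =
      ∑ p : TorusSite 4 L × Fin N × Fin 4, ∑ μ : Fin 4, ∑ b : Fin N, ∑ β : Fin 4,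
        star (ψ p) * ((![1, 1, -1, -1] : Fin 4 → ℂ) p.2.2 *
          ((r : ℂ) • (1 : Matrix (Fin 4) (Fin 4) ℂ) - euclideanGamma μ) p.2.2 β) *
          ρ (U (p.1, μ)) p.2.1 b *
          ψ (Literature.MathematicalPhysics.QuantumFieldTheory.Site.shift p.1 μ, b, β) := by
    refine Finset.sum_congr rfl fun p _ => ?_
    rw [Finset.sum_comm]
    refine Finset.sum_congr rfl fun μ _ => ?_
    have : ∀ q, star (ψ p) * F p q μ * ψ q =
        if q.1 = Literature.MathematicalPhysics.QuantumFieldTheory.Site.shift p.1 μ then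
          star (ψ p) * ((![1, 1, -1, -1] : Fin 4 → ℂ) p.2.2 *
            ((r : ℂ) • (1 : Matrix (Fin 4) (Fin 4) ℂ) - euclideanGamma μ) p.2.2 q.2.2) *
            ρ (U (p.1, μ)) p.2.1 q.2.1 * ψ q else 0 := by
      intro q
      simp only [hF]
      split_ifs <;> ring
    simp_rw [this]
    rw [coareaWegner_sum_ite_fst_eq]
  -- the backward sum is the conjugate of the forward sum
  have hbwd : ∑ p, ∑ q, ∑ μ, star (ψ p) * star (F q p μ) * ψ q =
      star (∑ p, ∑ q, ∑ μ, star (ψ p) * F p q μ * ψ q) := by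
    rw [Finset.sum_comm]
    simp only [star_sum, star_mul', star_star]
    exact Finset.sum_congr rfl fun q _ => Finset.sum_congr rfl fun p _ =>
      Finset.sum_congr rfl fun μ _ => by ring
  -- the mass term
  have hmass : ∑ p : TorusSite 4 L × Fin N × Fin 4, ∑ q,
      (if p = q then ((m + 4 * r : ℝ) : ℂ) * ((![1, 1, -1, -1] : Fin 4 → ℂ) p.2.2 * (star (ψ p) * ψ p))
        else 0) =
      ∑ p, ((m + 4 * r : ℝ) : ℂ) * ((![1, 1, -1, -1] : Fin 4 → ℂ) p.2.2 * (star (ψ p) * ψ p)) := by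
    refine Finset.sum_congr rfl fun p _ => ?_
    rw [Finset.sum_ite_eq]
    simp
  calc star ψ ⬝ᵥ (spinorLift gammaFive * wilsonDirac ρ U m r).mulVec ψ
      = ∑ p, ∑ q, star (ψ p) * ((![1, 1, -1, -1] : Fin 4 → ℂ) p.2.2 * wilsonDirac ρ U m r p q) *
          ψ q := by
        simp only [dotProduct, mulVec, Pi.star_apply, hH, Finset.mul_sum, mul_assoc]
    _ = ∑ p, ∑ q, ((if p = q then
            ((m + 4 * r : ℝ) : ℂ) * ((![1, 1, -1, -1] : Fin 4 → ℂ) p.2.2 * (star (ψ p) * ψ p)) else 0) -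
          (1 / 2 : ℂ) * (∑ μ, star (ψ p) * F p q μ * ψ q + ∑ μ, star (ψ p) * star (F q p μ) * ψ q)) := by
        simp only [hpt]
    _ = (∑ p, ∑ q, (if p = q then
            ((m + 4 * r : ℝ) : ℂ) * ((![1, 1, -1, -1] : Fin 4 → ℂ) p.2.2 * (star (ψ p) * ψ p)) else 0)) -
          (1 / 2 : ℂ) * ((∑ p, ∑ q, ∑ μ, star (ψ p) * F p q μ * ψ q) +
            ∑ p, ∑ q, ∑ μ, star (ψ p) * star (F q p μ) * ψ q) := by
        simp only [Finset.sum_sub_distrib, Finset.sum_add_distrib, Finset.mul_sum, mul_add]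
    _ = _ := by
        rw [hmass, hbwd, hfwd, Complex.star_def, Complex.add_conj]
        push_cast
        ring

/-- **The forward-hop sum as a sum over edges.**  Re-indexing `(p, μ) = ((x, a, α), μ) ↦ (e, a, α)`,
`e = (x, μ)`: the forward sum `Φ` of `coareaWegner_quadForm_eq` is `Σ_e G_e(ρ(U e))` with
`G_e(M) = Σ_{a b α β} conj ψ(x,a,α) · ε_α (r − γ_μ)_{αβ} · M_{ab} · ψ(x + μ̂, b, β)` depending on the
gauge field only through the single link `U e`. -/
theorem coareaWegner_fwdSum_eq_edgeSum [NeZero L] (U : GaugeConfig 4 L G) (r : ℝ)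
    (ψ : TorusSite 4 L × Fin N × Fin 4 → ℂ) :
    (∑ p : TorusSite 4 L × Fin N × Fin 4, ∑ μ : Fin 4, ∑ b : Fin N, ∑ β : Fin 4,
        star (ψ p) * ((![1, 1, -1, -1] : Fin 4 → ℂ) p.2.2 *
          ((r : ℂ) • (1 : Matrix (Fin 4) (Fin 4) ℂ) - euclideanGamma μ) p.2.2 β) *
          ρ (U (p.1, μ)) p.2.1 b *
          ψ (Literature.MathematicalPhysics.QuantumFieldTheory.Site.shift p.1 μ, b, β)) =
      ∑ e : Edge 4 L, ∑ a : Fin N, ∑ b : Fin N, ∑ α : Fin 4, ∑ β : Fin 4,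
        star (ψ (e.1, a, α)) * ((![1, 1, -1, -1] : Fin 4 → ℂ) α *
          ((r : ℂ) • (1 : Matrix (Fin 4) (Fin 4) ℂ) - euclideanGamma e.2) α β) *
          ρ (U e) a b *
          ψ (Literature.MathematicalPhysics.QuantumFieldTheory.Site.shift e.1 e.2, b, β) := by
  conv_lhs => rw [Fintype.sum_prod_type]
  conv_rhs => rw [Fintype.sum_prod_type]
  refine Finset.sum_congr rfl fun x _ => ?_
  rw [Finset.sum_comm]
  refine Finset.sum_congr rfl fun μ _ => ?_
  rw [Fintype.sum_prod_type]
  refine Finset.sum_congr rfl fun a _ => ?_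
  rw [Finset.sum_comm]

end General

/-- **Bridge lemma A (Hellmann–Feynman colour-current identity).**  For the Hermitian Wilson operator
`H(U) = Γ₅ D_W(U, m₀, 1)` on the four-torus of any side `L ≥ 1`, a gauge field `W`, a link
`e = (z, μ)`, a matrix `X` and any curve `g : ℝ → SU(3)` whose matrix entries have derivative `X` at
`t = 0`, and any field `ψ`, the quadratic form `t ↦ Re ⟨ψ, H(W[e ↦ W(e) g(t)]) ψ⟩` has derivative at
`t = 0` equal to the colour current
`J_{e,X}(ψ) = 2 Re Σ_{a b α β} conj ψ(z,a,α) (γ₅ (−½)(1 − γ_μ))_{αβ} (W(e) X)_{ab} ψ(z + μ̂, b, β)`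
— verbatim the current expression of `stub_currentRigidity` / `stub_coareaWegner`.  (Hellmann–Feynman:
for a normalised eigenvector `ψ` on an analytic branch `λ(t)`, `λ'(0) = J_{e,X}(ψ)`.) -/
theorem coareaWegner_hellmannFeynman {L : ℕ} [NeZero L] (W : GaugeConfig 4 L SU3) (m₀ : ℝ)
    (z : TorusSite 4 L) (μ : Fin 4) (X : Matrix (Fin 3) (Fin 3) ℂ) (g : ℝ → SU3)
    (hg : ∀ a b : Fin 3, HasDerivAt (fun t => ((g t : SU3) : Matrix (Fin 3) (Fin 3) ℂ) a b) (X a b) 0)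
    (ψ : QuarkIdx L → ℂ) :
    HasDerivAt
      (fun t => (star ψ ⬝ᵥ (spinorLift gammaFive * wilsonDirac (fundamentalRep (Fin 3))
        (Function.update W (z, μ) (W (z, μ) * g t)) m₀ 1).mulVec ψ).re)
      (2 * (∑ a : Fin 3, ∑ b : Fin 3, ∑ α : Fin 4, ∑ β : Fin 4,
        star (ψ (z, a, α)) *
          (gammaFive * ((-(1 / 2 : ℂ)) • ((1 : Matrix (Fin 4) (Fin 4) ℂ) - euclideanGamma μ))) α β *
          (((W (z, μ) : SU3) : Matrix (Fin 3) (Fin 3) ℂ) * X) a b *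
          ψ (Literature.MathematicalPhysics.QuantumFieldTheory.Site.shift z μ, b, β)).re) 0 := by
  -- the one-link amplitude `G e' M`
  set Gf : Edge 4 L → Matrix (Fin 3) (Fin 3) ℂ → ℂ := fun e' M =>
    ∑ a : Fin 3, ∑ b : Fin 3, ∑ α : Fin 4, ∑ β : Fin 4,
      star (ψ (e'.1, a, α)) * ((![1, 1, -1, -1] : Fin 4 → ℂ) α *
        (((1 : ℝ) : ℂ) • (1 : Matrix (Fin 4) (Fin 4) ℂ) - euclideanGamma e'.2) α β) *
        M a b * ψ (Literature.MathematicalPhysics.QuantumFieldTheory.Site.shift e'.1 e'.2, b, β)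
    with hGf
  have hρ : ∀ u : SU3, fundamentalRep (Fin 3) u ∈ Matrix.unitaryGroup (Fin 3) ℂ :=
    fun u => fundamentalRep_mem_unitaryGroup u
  -- Step 1: the quadratic form for an arbitrary gauge field
  have h1 : ∀ U : GaugeConfig 4 L SU3,
      (star ψ ⬝ᵥ (spinorLift gammaFive * wilsonDirac (fundamentalRep (Fin 3)) U m₀ 1).mulVec ψ).re =
        (∑ p, ((m₀ + 4 * 1 : ℝ) : ℂ) * ((![1, 1, -1, -1] : Fin 4 → ℂ) p.2.2 * (star (ψ p) * ψ p))).re -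
          (∑ e', Gf e' ((U e' : SU3) : Matrix (Fin 3) (Fin 3) ℂ)).re := by
    intro U
    rw [coareaWegner_quadForm_eq _ hρ, coareaWegner_fwdSum_eq_edgeSum, Complex.sub_re,
      Complex.ofReal_re]
    simp only [hGf, fundamentalRep_apply]
  -- Step 2: isolate the link `e = (z, μ)`
  have h2 : ∀ v : SU3, ∑ e', Gf e' ((Function.update W (z, μ) v e' : SU3) : Matrix (Fin 3) (Fin 3) ℂ) =
      Gf (z, μ) (v : Matrix (Fin 3) (Fin 3) ℂ) +
        ∑ e' ∈ Finset.univ \ {(z, μ)}, Gf e' ((W e' : SU3) : Matrix (Fin 3) (Fin 3) ℂ) := by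
    intro v
    have : (fun e' => Gf e' ((Function.update W (z, μ) v e' : SU3) : Matrix (Fin 3) (Fin 3) ℂ)) =
        Function.update (fun e' => Gf e' ((W e' : SU3) : Matrix (Fin 3) (Fin 3) ℂ)) (z, μ)
          (Gf (z, μ) (v : Matrix (Fin 3) (Fin 3) ℂ)) := by
      funext e'
      exact Function.apply_update (fun e' (u : SU3) => Gf e' (u : Matrix (Fin 3) (Fin 3) ℂ)) W (z, μ) v e'
    rw [this, Finset.sum_update_of_mem (Finset.mem_univ _)]
  -- Step 3: the derivative of the one-link amplitude along the curve
  have h3 : HasDerivAt (fun t => Gf (z, μ) (((W (z, μ) : SU3) : Matrix (Fin 3) (Fin 3) ℂ) *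
      ((g t : SU3) : Matrix (Fin 3) (Fin 3) ℂ)))
      (Gf (z, μ) (((W (z, μ) : SU3) : Matrix (Fin 3) (Fin 3) ℂ) * X)) 0 := by
    simp only [hGf, Matrix.mul_apply]
    refine HasDerivAt.fun_sum fun a _ => HasDerivAt.fun_sum fun b _ =>
      HasDerivAt.fun_sum fun α _ => HasDerivAt.fun_sum fun β _ => ?_
    refine HasDerivAt.mul_const ?_ _
    refine HasDerivAt.const_mul _ ?_
    exact HasDerivAt.fun_sum fun k _ => (hg k b).const_mul _
  have h3re := (Complex.reCLM.hasFDerivAt.comp_hasDerivAt (0 : ℝ) h3)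
  simp only [Function.comp_def, Complex.reCLM_apply] at h3re
  -- Step 4: assemble
  have h4 : (fun t => (star ψ ⬝ᵥ (spinorLift gammaFive * wilsonDirac (fundamentalRep (Fin 3))
        (Function.update W (z, μ) (W (z, μ) * g t)) m₀ 1).mulVec ψ).re) = fun t =>
      ((∑ p, ((m₀ + 4 * 1 : ℝ) : ℂ) * ((![1, 1, -1, -1] : Fin 4 → ℂ) p.2.2 * (star (ψ p) * ψ p))).re -
          (∑ e' ∈ Finset.univ \ {(z, μ)}, Gf e' ((W e' : SU3) : Matrix (Fin 3) (Fin 3) ℂ)).re) -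
        (Gf (z, μ) (((W (z, μ) : SU3) : Matrix (Fin 3) (Fin 3) ℂ) *
          ((g t : SU3) : Matrix (Fin 3) (Fin 3) ℂ))).re := by
    funext t
    rw [h1, h2, Submonoid.coe_mul, Complex.add_re]
    ring
  rw [h4]
  refine (h3re.const_sub _).congr_deriv ?_
  -- the derivative value is the colour current
  have hγ : ∀ α β : Fin 4,
      (gammaFive * ((-(1 / 2 : ℂ)) • ((1 : Matrix (Fin 4) (Fin 4) ℂ) - euclideanGamma μ))) α β =
        (((-(1 / 2) : ℝ)) : ℂ) * ((![1, 1, -1, -1] : Fin 4 → ℂ) α *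
          (((1 : ℝ) : ℂ) • (1 : Matrix (Fin 4) (Fin 4) ℂ) - euclideanGamma μ) α β) := by
    intro α β
    rw [gammaFive_eq_diagonal, diagonal_mul, Matrix.smul_apply, smul_eq_mul, Complex.ofReal_one,
      one_smul]
    push_cast
    ring
  have hsum : (∑ a : Fin 3, ∑ b : Fin 3, ∑ α : Fin 4, ∑ β : Fin 4,
      star (ψ (z, a, α)) *
        (gammaFive * ((-(1 / 2 : ℂ)) • ((1 : Matrix (Fin 4) (Fin 4) ℂ) - euclideanGamma μ))) α β *
        (((W (z, μ) : SU3) : Matrix (Fin 3) (Fin 3) ℂ) * X) a b *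
        ψ (Literature.MathematicalPhysics.QuantumFieldTheory.Site.shift z μ, b, β)) =
      (((-(1 / 2) : ℝ)) : ℂ) * Gf (z, μ) (((W (z, μ) : SU3) : Matrix (Fin 3) (Fin 3) ℂ) * X) := by
    simp only [hGf, Finset.mul_sum]
    refine Finset.sum_congr rfl fun a _ => Finset.sum_congr rfl fun b _ =>
      Finset.sum_congr rfl fun α _ => Finset.sum_congr rfl fun β _ => ?_
    rw [hγ]
    ring
  rw [hsum, Complex.re_ofReal_mul]
  ring

end Summit.QuantumFields.QCD.Cruxes.WegnerEstimate.ResolventCell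

end
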